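import Literature.NumberTheory.GelbartRogawski1991.ThetaDichotomyVocabulary
import HarnessLib

/-!
# [Rogawski1992 Prop. 3.4; HarrisKudlaSweet1996 Cor. 4.4 (m = n = 1)] The `(U(1), U(1))` theta dichotomy at a
# non-split place, in CM currency: every character of `E¹_v` occurs in the rank-one Weil representation `ω¹` of
# SOME hermitian line class and NOT in the other

Topic `NumberTheory/GelbartRogawski1991`; namespace `Literature.NumberTheory.GelbartRogawski1991` (the story of the ★ vocabulary
`ThetaDichotomyVocabulary`: `lineWeilCM`, `OccursInLineWeilCM`, and of ★ `thetaType_nonsplit_borelEigenfunctional`,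
★ `GR90Prop522_thetaType_supercuspidal_iff`, ★ `xiLocalPacket_nonsplit_isThetaPair`).  ONE named fact (`def … : Prop`, +1) and three proved
by-name lemmas; no `sorry`, no instance, no notation.  ED. 2 (2026-08-31T15:3xZ, typ-T7b): regularity hypothesis on `ψ` = `Continuous` (was `IsOpen ker`
in ED. 1 ★ p826953, which had no consumer yet); nothing else changed.  Cell `hodgecm-mathlib` (D-0151), programme P2 ∕ director g16 topic T7 (GR91 §5 local
theta dichotomy), seat typ-T7b (g0); requested on the F0∕P2 bus by F0P2-p01 (g7) 2026-08-31T15:12:34Z («(α) BOOK the existence half as a PRINT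
LETTER») for the K1 sub-line `Cruxes/H413/Lines/F0_P2GR91NJacquetK1.lean` (piece «K1occ»), and consumed a second time by the OCC stub
`StubNonOccurringClass` of the T7b Lines draft `F0/P2/Lines-draft/T7b_LocalThetaDichotomy.lean` (non-occurring class).

## The printed result and the dictionary

Let `E_w ∕ F_v` be the local quadratic extension at a finite place `v` of `F = L⁺` non-split in the CM field `E = L`, `ψ_F` the fixed additive
character, and `χ` a character of `E_w^×` with `χ|_{F_v^×} = ε_{E/F}` (a splitting character; in the tree `χ = μ_w` for a conjugate-symplectic
`μ`, ★ `isOscillatorChar_toHeckeCharacter_iff`).  For the dual pair `(U(W), U(V))` of HERMITIAN LINES (`dim_E W = dim_E V = 1`,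
`U(W)(F_v) = U(V)(F_v) = E_w¹`) the `χ`-split Weil representation `ω_χ(W ⊗ V)` restricted to the compact torus `E_w¹` decomposes with
multiplicity one, and [HarrisKudlaSweet1996, Cor. 4.4 with m = n = 1, p. 962]: «fix a character `χ` of `E^×` such that `χ|_{F^×} = ε_{E/F}` …
Then at most one of the two theta lifts `Θ_χ(π, V^±)` is non-zero. Moreover, if `m = n` then precisely one is non-zero» — for every
character `π` of `U(W) = E_w¹` (every irreducible representation of the compact group `U(W)` is supercuspidal, so the proviso of Cor. 4.4 is
void), `π` OCCURS in `ω_χ(W ⊗ V)` for exactly one of the two isometry classes `V^±` of hermitian lines (classes of `a ∈ F_v^×` modulo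
`N(E_w^×)`, two of them at a non-split `v`); the deciding sign is the root number [HarrisKudlaSweet1996, Thm. 6.1 (ii) p. 967]
«`Θ_χ(π^∨, V) ≠ 0 ⟺ ε(½, π, χ, ψ) = ε_{E/F}(−2)^n · ε_{E/F}(det V)`», and «in the case `n = 1`, Theorem 6.1 was already obtained by
Rogawski [41]» [p. 968 L39] = [Rogawski1992, Prop. 3.4] («the key point turns out to be the criterion (Prop. 3.4 below) [for a character
to] occur in the local Howe correspondence for the simplest dual pair `(U(1), U(1))`», p. 397), valid in EVERY residual characteristic
([MuraseSugano2000, Remark after the Theorem of the Introduction p. 276]: «first proven by Moen ([Mo]) in the case where the residual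
characteristic of `F` is odd. Later Rogawski ([Ro]) completed the proof in the even residual characteristic case»; [Moen1993]).
[GelbartRogawski1991, Remark p. 466] records the same statement as the local content of Lemma 5.1.2: «for given `γ` and `χ`, there exists a
unique class of `ψ` such that `χ` occurs in `ω¹(γ, ψ)`» (their parametrisation of the two oscillator representations of `U(1)` by additive
characters `ψ` modulo norms ↔ ours by line classes `ε` modulo norms; NB their Cor. 5.2.2 p. 467 is the GLOBAL theta-series statement and is
not what is vendored here).

DICTIONARY (★ `ThetaDichotomyVocabulary` §2): `W = ⟨dL⟩`, `V = V_ε = ⟨ε⟩` (Gram `JW ε = (ε)`, ★ `Def411WeilCarriers.JW`), `ω_χ(W ⊗ V_ε)|_{E_w¹}` =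
★ `lineWeilCM L e₀ dL hdL hdL0 μ hμ ε v` (Kudla's `μ`-normalised CM splittings ★ `lineSplittingsCM`, read on the `U((ε))`-member, = `E_w¹` via
`det`), «`π = ψ` occurs» = ★ `OccursInLineWeilCM … ε v ψ` (the `ψ ∘ det`-weight space is non-zero; for the compact abelian `E_w¹` acting
smoothly this is `Θ_χ(ψ, V_ε) ≠ 0`).  As `ε` ranges over `(L⁺)^× ⊂ F_v^×` (dense) both classes modulo `N(E_w^×)` are met.

## What is vendored (and what is not)

`u1ThetaDichotomy_nonsplit` is the TWO-SIDED EXISTENCE form of the dichotomy — for every CONTINUOUS character `ψ` of `E_w¹` (ED. 2: the regularity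
hypothesis was `IsOpen ker` in ED. 1; on the compact totally disconnected `E_w¹` a character into `ℂˣ` is continuous iff its kernel is open, so the
change is print-neutral — HKS96 ∕ Rogawski1992 speak of characters of `U(1)` — and formally the stronger letter; requested by the consumer F0P2-p01 (g7)
2026-08-31T15:25:41Z before any consumer landed, because continuity is what ★ `IsThetaCenterChar` + `Continuous χ_f` deliver in-house and what the
pay-down road converts to MVW's `IsOpen ξ.ker` by ★ `UnitaryGroupNonsplitTorus.isOpen_ker_of_smul_eq`):
SOME line `ε` has `ψ` occurring in `ω¹_ε` AND SOME line `ε′` has `ψ` NOT occurring — i.e. «precisely one of the two classes» read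
through representatives; it is implied by the printed statement and is exactly what the two consumers destructure
(`u1Occurrence_exists` = F0P2-p01's binder text verbatim; `u1Occurrence_exists_not` = the OCC stub's core).  NOT vendored: the clause
«unique modulo norms» (if `ψ` occurs for `ε` and `ε′` then `ε′ε⁻¹ ∈ N(E_w^×)`) and the root-number formula of Thm. 6.1 (ii) — no consumer,
and they need the norm-class ∕ local-ε-factor vocabulary.  -- TODO(general form): HKS96 Cor. 4.4 ∕ Thm. 6.1 for `dim W = dim V = n`.

PAY-DOWN ROAD (booked, not used here): the ★ PROVED character-route dichotomy `MoeglinVignerasWaldspurger1987.rankOne_theta_dichotomy`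
(«`dim ω_{s₁}[ξ] + dim ω_{s₂}[ξθ] = 1`» for two sections over lines in different classes, with an unspecified ratio character `θ`) gives
this fact once `θ = 1` is computed for the two CM sections of ★ `lineSplittingsCM` at `ε`, `αε` (`(α, d)_v = −1`) — the in-house item
«N3′ ∕ θ-pinning» (`Theorems/F0P2oCMSectionsThetaOne.lean`, desk F0P2-plan (g7) 2026-08-31T15:13:08Z) — plus the existence of a non-norm
class at a non-split `v` (local class field theory); then `theorem u1ThetaDichotomy_nonsplit_holds` is appended here.

## References
* [HarrisKudlaSweet1996] M. Harris, S. Kudla, W. Sweet, *Theta dichotomy for unitary groups*, J. Amer. Math. Soc. 9 (1996) 941–1004: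
  Cor. 4.4 p. 962 (m = n: «precisely one is non-zero»), Thm. 6.1 p. 967, p. 968 L39 (n = 1 due to Rogawski) — exact items on the cell shelf
  `shelf/HKS96-HarrisKudlaSweet1996-JAMS9-and-Moen1987.md`.
* [Rogawski1992] J. Rogawski, *The multiplicity formula for A-packets*, in: The zeta functions of Picard modular surfaces (CRM, 1992)
  395–419: Prop. 3.4 (occurrence in the local Howe correspondence for `(U(1), U(1))`), p. 397 («the key point») — shelf
  `shelf/R2-Rogawski1992-MultiplicityFormulaAPackets-CRM.md`.
* [Moen1993] C. Moen, *The dual pair (U(1), U(1)) over a p-adic field*, Pacific J. Math. 158 (1993) 365–386 (odd residual characteristic).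
* [MuraseSugano2000] A. Murase, T. Sugano, *Local theory of primitive theta functions*, Compositio Math. 123 (2000) 273–302: Theorem of the
  Introduction (i) p. 276 (= Thm. 6.4: «a unitary character `ω` of `K^×` appears in `V` iff … `ε(ω; c_K) = ω(κ⁻¹)`, and its multiplicity is
  equal to one») and the Remark following it (history: Moen odd `p`, Rogawski all `p`, HKS local proof) — held `paper:doi-10-1023-a-1002051017269` p. 4.
* [GelbartRogawski1991] S. Gelbart, J. Rogawski, Invent. Math. 105 (1991): Remark p. 466; Lemma 5.1.2 p. 466; (Cor. 5.2.2 p. 467 — global).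
* [MoeglinVignerasWaldspurger1987] LNM 1291, Chap. 3 §IV.4 (★ `rankOne_theta_dichotomy`, the pay-down road).
-/

set_option autoImplicit false

noncomputable section

open NumberField IsDedekindDomain MeasureTheory
open scoped Matrix Kronecker

namespace Literature.NumberTheory.GelbartRogawski1991

open Literature.NumberTheory Literature.NumberTheory.Automorphic Literature.NumberTheory.Automorphic.UnitaryGroup
open Literature.NumberTheory.Automorphic.IdeleClassGroup
open Literature.NumberTheory.GaloisRepresentations
open Literature.NumberTheory.Rogawski1990

set_option synthInstance.maxHeartbeats 400000 in
set_option maxHeartbeats 8000000 in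
/-- **The `(U(1), U(1))` theta dichotomy at a non-split place (two-sided existence form).**  For a CM field `L`, a hermitian line
`⟨dL⟩` (`dL` real and non-zero), a conjugate-symplectic `μ` (the splitting character), and a finite place `v` of `L⁺` NON-SPLIT in `L`:
for every CONTINUOUS character `ψ` of `E¹_v = ↥(normOneUnits (L ⊗ L⁺_v))` (ED. 2; ⟺ open kernel on the profinite `E¹_v`), there is a line `ε ∈ (L⁺)^×` such that `ψ` OCCURS in the
rank-one Weil representation `ω¹_ε = ω_μ(⟨dL⟩ ⊗ ⟨ε⟩)|_{E¹_v}` (★ `OccursInLineWeilCM … ε v ψ`), and there is a line `ε′` such that `ψ` does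
NOT occur in `ω¹_{ε′}` — «precisely one of the two theta lifts `Θ_χ(π, V^±)` is non-zero» for `π = ψ`, `dim W = dim V = 1`, read through
representatives of the two classes of lines modulo norms.
[cite: HarrisKudlaSweet1996, Cor. 4.4 (m = n = 1) p. 962; Thm. 6.1 (ii) p. 967; p. 968 L39] [cite: Rogawski1992, Prop. 3.4; p. 397]
[cite: MuraseSugano2000, Thm. of the Introduction (i) + Remark p. 276] [cite: Moen1993] [cite: GelbartRogawski1991, Remark p. 466] -/
def u1ThetaDichotomy_nonsplit : Prop :=
  ∀ (L : Type) [Field L] [NumberField L] [IsCMField L] {n₀ : ℕ} (e₀ : Fin 1 × Fin 1 ≃ Fin n₀) (dL : Fin 1 → L)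
    (hdL : ∀ i, IsCMField.complexConj L (dL i) = dL i) (hdL0 : ∀ i, dL i ≠ 0)
    (μ : Literature.NumberTheory.Automorphic.IdeleClassGroup L →ₜ* Circle) (hμ : IsConjugateSymplectic L μ)
    (v : HeightOneSpectrum (𝓞 ↥(maximalRealSubfield L))),
    (∀ w : PlacesOver L v, IsCMField.complexConj L • w.1 = w.1) →
    ∀ ψ : ↥(normOneUnits (conjLocal L (IsCMField.complexConj L) v)) →* ℂˣ,
      (Continuous fun β => ((ψ β : ℂˣ) : ℂ)) →
      (∃ ε : (↥(maximalRealSubfield L))ˣ, OccursInLineWeilCM L e₀ dL hdL hdL0 μ hμ ε v ψ) ∧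
        (∃ ε' : (↥(maximalRealSubfield L))ˣ, ¬ OccursInLineWeilCM L e₀ dL hdL hdL0 μ hμ ε' v ψ)

set_option synthInstance.maxHeartbeats 400000 in
set_option maxHeartbeats 8000000 in
/-- **Existence half, by name** (the binder text of F0P2-p01 (g7)'s «K1occ», F0∕P2 bus 2026-08-31T15:12:34Z, verbatim): at a non-split `v`
every continuous character `ψ` of `E¹_v` occurs in `ω¹_ε` for SOME line `ε` (ED. 2: `Continuous` replaces `IsOpen ker`, as in p01's binder v2 583735870065cb50). [cite: HarrisKudlaSweet1996, Cor. 4.4 (m = n = 1) p. 962]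
[cite: Rogawski1992, Prop. 3.4] [cite: GelbartRogawski1991, Remark p. 466] -/
theorem u1Occurrence_exists (h : u1ThetaDichotomy_nonsplit) :
    ∀ (L : Type) [Field L] [NumberField L] [IsCMField L] {n₀ : ℕ} (e₀ : Fin 1 × Fin 1 ≃ Fin n₀) (dL : Fin 1 → L)
      (hdL : ∀ i, IsCMField.complexConj L (dL i) = dL i) (hdL0 : ∀ i, dL i ≠ 0)
      (μ : Literature.NumberTheory.Automorphic.IdeleClassGroup L →ₜ* Circle) (hμ : IsConjugateSymplectic L μ)
      (v : HeightOneSpectrum (𝓞 ↥(maximalRealSubfield L))),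
      (∀ w : PlacesOver L v, IsCMField.complexConj L • w.1 = w.1) →
      ∀ ψ : ↥(normOneUnits (conjLocal L (IsCMField.complexConj L) v)) →* ℂˣ,
        (Continuous fun β => ((ψ β : ℂˣ) : ℂ)) →
        ∃ ε : (↥(maximalRealSubfield L))ˣ, OccursInLineWeilCM L e₀ dL hdL hdL0 μ hμ ε v ψ :=
  fun L _ _ _ _ e₀ dL hdL hdL0 μ hμ v hv ψ hψ => (h L e₀ dL hdL hdL0 μ hμ v hv ψ hψ).1

set_option synthInstance.maxHeartbeats 400000 in
set_option maxHeartbeats 8000000 in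
/-- **Non-occurrence half, by name** (the core of the OCC stub `StubNonOccurringClass` of the T7b Lines draft): at a non-split `v` every
continuous character `ψ` of `E¹_v` FAILS to occur in `ω¹_{ε′}` for SOME line `ε′` (the other class).
[cite: HarrisKudlaSweet1996, Cor. 4.4 (m = n = 1) p. 962] [cite: Rogawski1992, Prop. 3.4] [cite: GelbartRogawski1991, Remark p. 466] -/
theorem u1Occurrence_exists_not (h : u1ThetaDichotomy_nonsplit) :
    ∀ (L : Type) [Field L] [NumberField L] [IsCMField L] {n₀ : ℕ} (e₀ : Fin 1 × Fin 1 ≃ Fin n₀) (dL : Fin 1 → L)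
      (hdL : ∀ i, IsCMField.complexConj L (dL i) = dL i) (hdL0 : ∀ i, dL i ≠ 0)
      (μ : Literature.NumberTheory.Automorphic.IdeleClassGroup L →ₜ* Circle) (hμ : IsConjugateSymplectic L μ)
      (v : HeightOneSpectrum (𝓞 ↥(maximalRealSubfield L))),
      (∀ w : PlacesOver L v, IsCMField.complexConj L • w.1 = w.1) →
      ∀ ψ : ↥(normOneUnits (conjLocal L (IsCMField.complexConj L) v)) →* ℂˣ,
        (Continuous fun β => ((ψ β : ℂˣ) : ℂ)) →
        ∃ ε' : (↥(maximalRealSubfield L))ˣ, ¬ OccursInLineWeilCM L e₀ dL hdL hdL0 μ hμ ε' v ψ :=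
  fun L _ _ _ _ e₀ dL hdL hdL0 μ hμ v hv ψ hψ => (h L e₀ dL hdL hdL0 μ hμ v hv ψ hψ).2

set_option synthInstance.maxHeartbeats 400000 in
set_option maxHeartbeats 8000000 in
/-- **The two witnesses differ**: under the dichotomy, an occurring line and a non-occurring line for the same `ψ` are distinct elements of
`(L⁺)^×` (trivial bookkeeping the OCC consumer uses to see two different lines). [cite: HarrisKudlaSweet1996, Cor. 4.4 (m = n = 1) p. 962] -/
theorem u1Occurrence_witnesses_ne {L : Type} [Field L] [NumberField L] [IsCMField L] {n₀ : ℕ} {e₀ : Fin 1 × Fin 1 ≃ Fin n₀} {dL : Fin 1 → L}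
    {hdL : ∀ i, IsCMField.complexConj L (dL i) = dL i} {hdL0 : ∀ i, dL i ≠ 0}
    {μ : Literature.NumberTheory.Automorphic.IdeleClassGroup L →ₜ* Circle} {hμ : IsConjugateSymplectic L μ}
    {v : HeightOneSpectrum (𝓞 ↥(maximalRealSubfield L))} {ψ : ↥(normOneUnits (conjLocal L (IsCMField.complexConj L) v)) →* ℂˣ}
    {ε ε' : (↥(maximalRealSubfield L))ˣ} (hε : OccursInLineWeilCM L e₀ dL hdL hdL0 μ hμ ε v ψ)
    (hε' : ¬ OccursInLineWeilCM L e₀ dL hdL hdL0 μ hμ ε' v ψ) : ε ≠ ε' := by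
  rintro rfl
  exact hε' hε

end Literature.NumberTheory.GelbartRogawski1991

end
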